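import Summits.QuantumFields.YangMills.Theorems.UnitScaleTiltProp7LocMinOfJointRow
import HarnessLib

/-!
# S2β · organ GAP♯∘ ∕ POS∘ — (142) WITH ITS RATE, FILE 1∕2: THE ARITHMETIC DOOR (`growth_of_QRows`, `rate_arith`). FILE 2∕2 = `…S2BetaSigmaGrowthRate` (E2E + zero-hypothesis corollary).
# **[Balaban1985Variational] (142) WITH ITS RATE ON THE LANDAU Σ-SLICE, K-UNIFORM, ZERO ANALYTIC HYPOTHESES**:
# `c(L,B₁′)·L^{−2(K−n)}·Σ_b‖X b‖² ≤ A(W·e^{iX}) − A(W)` at every E–L-critical printed-regular background `W` and every Σ-competitor `X` in print's (19)(20)(21) window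

Cell `ym3-torus` (YM ladder rung R3 = continuum `SU(2)` Yang–Mills on T³ — a RUNG: NOT d = 4, NOT infinite volume, NOT a mass gap, NOT Clay).  Width seat `ym3-torus-px17` (gen 15),
FREE px helper of the crux `stmt-QuantumFields-20520` (`…Theses.UnitScaleTilt.FluctuationComparisonRegPrIntL`), `--supports … --as helper`, count-neutral, DEFINITION-FREE
(0 `def`, 0 `instance`, 0 `notation`, 0 `sorry`, default heartbeats).

WHY.  The S2ᵝ organ's positivity letter (POS∘ ∕ the (T)-chain's `hH` ∕ TUBE-REG∘'s `μ·L^{−2(K−J)}` rate) is [Balaban1985Variational] (141)–(143): STRICT quadratic growth of the Wilson action on the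
constraint fibre at print's regular minimiser, transversally to the residual gauge orbit, at rate `~L^{−2k}` uniformly in `k` ([Balaban1985BackgroundPropagators] Thm 3.11).  The 19200 lineage
proved (142) on the Landau Σ-slice as MINIMALITY (`≤`): ✓`Prop7HcoSClosed.hcoS_holds` ⟸ ✓`Prop7HcoSEndToEnd.hcoS_of_normG0_of_combRemainderRows` ⟸ {(N06) ✓`Prop7HN06Holds.hN06_holds`, (β) ✓},
whose last step (✓`Prop7HcoSOfGaugedRows.hcoS_of_gaugedRowsS` ∘ ✓`Prop7LocMinOfJointRow.linRow_of_QRows` ∘ ✓`wilsonAction4_le_expChart_of_linRow`) spends the whole HESS row `κΣ‖X‖² ≤ Σ_p‖ℒ_p X‖²`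
against the Taylor parameter `θ = ½` and drops the rate.  THIS FILE re-runs that last step at `θ = ⅓` — same discharged rows, same windows — and keeps `κ∕48`:
* §1 ★★ `growth_of_QRows` — the arithmetic door: (141) in the `Q`-currency + remainder row + HESS `κ` + the two windows of ✓`linRow_of_QRows` + `RegPr` + Hermitian-traceless `D` of sup-radius
  `s`, `4s ≤ 1` ⟹ `(κ∕48)·Σ_b‖D b‖² ≤ A(W·e^{iD}) − A(W)` (✓`Prop7Taylor3Uniform.wilsonAction4_expChart_sub_lin_ge` at `θ := ⅓`; `15552s² ≤ κ∕8` gives the `7776s²·3 − 15552s²` surplus room).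
* §2 ★★★ `sigmaGrowth_of_normG0_of_combRemainderRows (c₀ cB a₀)` — the E2E knit of ✓`hcoS_of_normG0_of_combRemainderRows` VERBATIM (★p1-19200 g18's proof, every row by name: (COERC)∧(LANDAU-S)
  ✓`coerc_landau_RcombL2_of_normG₀_of_isLandauPrint`, HESS on print's slice ✓`coercive_on_landau_of_coercive`, (SLOT) ✓`re_inner_DeltaEta_le_of_regPr`, (NORM), (QSMALL), `κ`∕windows
  ✓`Prop7SigmaE2EArith`, (JOINT) ✓`jointRow_of_l1_CmapTw`, (141) mod coarse gauge ✓`abs_lin_le_sum_norm_trueLinIter_weakEL_sub_coarseGauge`) with ONE extra window summand (`kQ·e ≤ 1`) and §1 as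
  the last step; CONCLUSION: `∀ L > 1, ∀ B₁′ > 0, ∃ e₇ c > 0` (`c := (480·B₀(L))⁻¹`, `B₀` the Thm-3.11 bound of (N06)) such that on `hcoS`'s binder
  `c·(L^{K−n})⁻²·Σ_b‖X b‖² ≤ A(W·e^{iX}) − A(W)`.
* §3 ★★★ `sigmaGrowth_holds` — §2 with BOTH rows discharged by name ((N06) := ✓`hN06_holds 1 1 1`, (P-A2⁺) := ✓`hPA2_of_diffL1 (hD_of_hMcomb hMcomb_holds hMc₂_holds hN2s_holds)`): **NO HYPOTHESIS, EVERY
  `L > 1`** — (142) with its K-uniform rate, the analytic content of POS∘ in Σ-coordinates.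
RESIDUE towards the S2β letters (kinematic, not typed here): slice change Landau-Σ at `W` ↔ the tube transversal `σ` of (T2a)–(T2c) (`hgrow`∕`hH`); group (4) ↔ residual (× centre); `dist1` ↔ HS;
E–L-criticality of the organ's base point `U₀ ∈ argminHist V ∩ regFibrePr ε₀` (a constrained minimiser).  The (19)-window is an `η`-scaled sup-ball (`‖X b‖ < 2B₁′e·η`), so this is the
depth-scaled tube, not TUBE-REG∘'s datum-free `δ` (prover-3 (F3) ∕ LOCATE-TUBE-REG §3c stand).
HONEST SCOPE.  One arithmetic lemma + a re-knit of landed rows; nothing of Bałaban's analysis is asserted beyond what the cited tree theorems prove; credits nothing to any item; POS∘∕`hH` on the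
tube chart, ISOL∘, TUBE-REG∘, GAP♯∘, EXW∘, 20520, `YM3TorusSU2` NOT proved.  Rung R3 = SU(2) YM₃ on T³ — NOT d = 4, NOT infinite volume, NOT a mass gap, NOT Clay; the YM mass gap is NOT proved.

References: T. Bałaban, CMP **102** (1985) 277–309 [Balaban1985Variational] ((19)–(21) p.281, (44)–(47) pp.285–286, (106)–(111) p.294, (116) p.295, (141)–(143) p.299); CMP **99** (1985)
389–434 [Balaban1985BackgroundPropagators] (Thm 3.3 p.399, Thm 3.11 p.416, (3.10)–(3.12) p.392, (3.26) p.395); CMP **98** (1985) 17–51 [Balaban1985Averaging] (Prop. 5 (157) p.41).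
-/

set_option autoImplicit false
noncomputable section

open scoped BigOperators Matrix.Norms.L2Operator Matrix Topology InnerProductSpace
open Filter

namespace Summit.QuantumFields.YangMills.Theorems.FluctuationComparisonRegPrIntLS2BetaSigmaGrowthDoor


open Literature.MathematicalPhysics.QuantumFieldTheory.Balaban1983to89
open Literature.MathematicalPhysics.QuantumFieldTheory.Balaban1983to89.T3ContinuumYM3Torus
open Literature.MathematicalPhysics.QuantumFieldTheory.Balaban1983to89.T3PrintedRegularMinimiser
open Literature.MathematicalPhysics.QuantumFieldTheory.Balaban1983to89.T3RegularMinimiser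

/-! ## §1 The arithmetic door: (142) with its rate from the `Q`-currency rows, Taylor at `θ = ⅓` -/

section Door

open Literature.MathematicalPhysics.QuantumFieldTheory.Balaban1983to89.T3SectALandauChart (emb15 pos_of_regPr)
open Summit.QuantumFields.YangMills.Theorems.Prop7TPrint (expHermField)
open Summit.QuantumFields.YangMills.Theorems.Prop7Taylor3Uniform (wilsonAction4_expChart_sub_lin_ge)

variable (F : T3Family) {n K : ℕ}

/-- ★★ **THE GROWTH ROW FROM THE `Q`-CURRENCY PIECES — (142) WITH ITS RATE.**  Same inputs as ✓`Prop7LocMinOfJointRow.linRow_of_QRows` ((141) in the `Q`-currency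
`|ℓ_W(D)| ≤ 2ε₀ℓ⁻¹R`, the remainder row `R ≤ C₁ℓ⁻¹Σ‖D‖² + C₂ℓΣ_p‖ℒ_p D‖²` with `C₁ ≥ 0`, HESS `κΣ‖D‖² ≤ Σ_p‖ℒ_p D‖²`, the windows `2ε₀C₂ ≤ ⅛`,
`2ε₀C₁ℓ⁻² + 15552s² + 216·regThreshold(e) ≤ κ∕8`) plus the background's regularity `RegPr F n K e W` and the Hermitian-traceless direction `D` of sup-radius `s`, `4s ≤ 1`:
then `(κ∕48)·Σ_b‖D b‖² ≤ A(W·e^{iD}) − A(W)`.  Proof: the scale-aware Taylor expansion ✓`wilsonAction4_expChart_sub_lin_ge` at `θ := 1∕3` (coefficient `(1−θ)∕2 = ⅓` on the curl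
square, `7776·3 = 23328` on `s²`) instead of the `θ = ½` of ✓`wilsonAction4_le_expChart_of_linRow`: `A(W·e^{iD}) − A(W) ≥ −|ℓ_W(D)| + ⅓Σ‖ℒD‖² − (23328s² + 216a)Σ‖D‖²
≥ (⅓ − ⅛)Σ‖ℒD‖² − (κ∕8)Σ‖D‖² − 7776s²Σ‖D‖² ≥ (5κ∕24 − κ∕8 − κ∕16)Σ‖D‖² = (κ∕48)Σ‖D‖²` (using `15552s² ≤ κ∕8`). [cite: Balaban1985Variational, (141)-(143) p.299, (116) p.295, (6) p.278] -/
theorem growth_of_QRows {e s ε₀ R C₁ C₂ κ : ℝ} (hε₀ : 0 ≤ ε₀) (hC₁ : 0 ≤ C₁) {W : GaugeField (F.P K) 0 (Matrix.specialUnitaryGroup (Fin 2) ℂ)} (hreg : RegPr F n K e W)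
    (D : PBond (F.P K) 0 → Matrix (Fin 2) (Fin 2) ℂ) (hDh : ∀ b : PBond (F.P K) 0, (D b).IsHermitian ∧ Matrix.trace (D b) = 0)
    (hDs : ∀ b : PBond (F.P K) 0, ‖D b‖ ≤ s) (hs4 : 4 * s ≤ 1)
    (hELQ : |∑ p : Plaq (F.P K) 0, (1 / 2) * (((((GaugeField.plaqHol W p : Matrix.specialUnitaryGroup (Fin 2) ℂ) : Matrix (Fin 2) (Fin 2) ℂ) - 1)ᴴ * (((Complex.I • D ⟨p.src, p.μ⟩) + ((W ⟨p.src, p.μ⟩ : Matrix (Fin 2) (Fin 2) ℂ) * (Complex.I • D ⟨p.src.shift p.μ, p.ν⟩) * star (W ⟨p.src, p.μ⟩ : Matrix (Fin 2) (Fin 2) ℂ))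
            - (((W ⟨p.src, p.μ⟩ * W ⟨p.src.shift p.μ, p.ν⟩ * (W ⟨p.src.shift p.ν, p.μ⟩)⁻¹ : Matrix.specialUnitaryGroup (Fin 2) ℂ) : Matrix (Fin 2) (Fin 2) ℂ) * (Complex.I • D ⟨p.src.shift p.ν, p.μ⟩) * star ((W ⟨p.src, p.μ⟩ * W ⟨p.src.shift p.μ, p.ν⟩ * (W ⟨p.src.shift p.ν, p.μ⟩)⁻¹ : Matrix.specialUnitaryGroup (Fin 2) ℂ) : Matrix (Fin 2) (Fin 2) ℂ))
            - (((GaugeField.plaqHol W p : Matrix.specialUnitaryGroup (Fin 2) ℂ) : Matrix (Fin 2) (Fin 2) ℂ) * (Complex.I • D ⟨p.src, p.ν⟩) * star ((GaugeField.plaqHol W p : Matrix.specialUnitaryGroup (Fin 2) ℂ) : Matrix (Fin 2) (Fin 2) ℂ))) * ((GaugeField.plaqHol W p : Matrix.specialUnitaryGroup (Fin 2) ℂ) : Matrix (Fin 2) (Fin 2) ℂ))).trace).re| ≤ 2 * ε₀ * ((F.L : ℝ) ^ (K - n))⁻¹ * R)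
    (hR : R ≤ C₁ * ((F.L : ℝ) ^ (K - n))⁻¹ * ∑ b : PBond (F.P K) 0, ‖D b‖ ^ 2 + C₂ * (F.L : ℝ) ^ (K - n) * ∑ p : Plaq (F.P K) 0, ‖((Complex.I • D ⟨p.src, p.μ⟩) + ((W ⟨p.src, p.μ⟩ : Matrix (Fin 2) (Fin 2) ℂ) * (Complex.I • D ⟨p.src.shift p.μ, p.ν⟩) * star (W ⟨p.src, p.μ⟩ : Matrix (Fin 2) (Fin 2) ℂ))
            - (((W ⟨p.src, p.μ⟩ * W ⟨p.src.shift p.μ, p.ν⟩ * (W ⟨p.src.shift p.ν, p.μ⟩)⁻¹ : Matrix.specialUnitaryGroup (Fin 2) ℂ) : Matrix (Fin 2) (Fin 2) ℂ) * (Complex.I • D ⟨p.src.shift p.ν, p.μ⟩) * star ((W ⟨p.src, p.μ⟩ * W ⟨p.src.shift p.μ, p.ν⟩ * (W ⟨p.src.shift p.ν, p.μ⟩)⁻¹ : Matrix.specialUnitaryGroup (Fin 2) ℂ) : Matrix (Fin 2) (Fin 2) ℂ))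
            - (((GaugeField.plaqHol W p : Matrix.specialUnitaryGroup (Fin 2) ℂ) : Matrix (Fin 2) (Fin 2) ℂ) * (Complex.I • D ⟨p.src, p.ν⟩) * star ((GaugeField.plaqHol W p : Matrix.specialUnitaryGroup (Fin 2) ℂ) : Matrix (Fin 2) (Fin 2) ℂ)))‖ ^ 2)
    (hq : κ * ∑ b : PBond (F.P K) 0, ‖D b‖ ^ 2 ≤ ∑ p : Plaq (F.P K) 0, ‖((Complex.I • D ⟨p.src, p.μ⟩) + ((W ⟨p.src, p.μ⟩ : Matrix (Fin 2) (Fin 2) ℂ) * (Complex.I • D ⟨p.src.shift p.μ, p.ν⟩) * star (W ⟨p.src, p.μ⟩ : Matrix (Fin 2) (Fin 2) ℂ))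
            - (((W ⟨p.src, p.μ⟩ * W ⟨p.src.shift p.μ, p.ν⟩ * (W ⟨p.src.shift p.ν, p.μ⟩)⁻¹ : Matrix.specialUnitaryGroup (Fin 2) ℂ) : Matrix (Fin 2) (Fin 2) ℂ) * (Complex.I • D ⟨p.src.shift p.ν, p.μ⟩) * star ((W ⟨p.src, p.μ⟩ * W ⟨p.src.shift p.μ, p.ν⟩ * (W ⟨p.src.shift p.ν, p.μ⟩)⁻¹ : Matrix.specialUnitaryGroup (Fin 2) ℂ) : Matrix (Fin 2) (Fin 2) ℂ))
            - (((GaugeField.plaqHol W p : Matrix.specialUnitaryGroup (Fin 2) ℂ) : Matrix (Fin 2) (Fin 2) ℂ) * (Complex.I • D ⟨p.src, p.ν⟩) * star ((GaugeField.plaqHol W p : Matrix.specialUnitaryGroup (Fin 2) ℂ) : Matrix (Fin 2) (Fin 2) ℂ)))‖ ^ 2)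
    (hw₁ : 2 * ε₀ * C₂ ≤ 1 / 8)
    (hw₂ : 2 * ε₀ * C₁ * (((F.L : ℝ) ^ (K - n)) ^ 2)⁻¹ + 15552 * s ^ 2 + 216 * regThreshold F n K e ≤ κ / 8) :
    κ / 48 * ∑ b : PBond (F.P K) 0, ‖D b‖ ^ 2 ≤ wilsonAction4 (emb15 W (expHermField D)) - wilsonAction4 W := by
  have hL1 : (1 : ℝ) ≤ (F.L : ℝ) := by have := F.hL.2; exact_mod_cast (by omega : 1 ≤ F.L)
  set ℓ : ℝ := (F.L : ℝ) ^ (K - n) with hℓ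
  have hℓ1 : 1 ≤ ℓ := one_le_pow₀ hL1
  have hℓ0 : 0 < ℓ := by linarith
  set M : ℝ := ∑ b : PBond (F.P K) 0, ‖D b‖ ^ 2 with hM
  set Kc : ℝ := ∑ p : Plaq (F.P K) 0, ‖((Complex.I • D ⟨p.src, p.μ⟩) + ((W ⟨p.src, p.μ⟩ : Matrix (Fin 2) (Fin 2) ℂ) * (Complex.I • D ⟨p.src.shift p.μ, p.ν⟩) * star (W ⟨p.src, p.μ⟩ : Matrix (Fin 2) (Fin 2) ℂ))
            - (((W ⟨p.src, p.μ⟩ * W ⟨p.src.shift p.μ, p.ν⟩ * (W ⟨p.src.shift p.ν, p.μ⟩)⁻¹ : Matrix.specialUnitaryGroup (Fin 2) ℂ) : Matrix (Fin 2) (Fin 2) ℂ) * (Complex.I • D ⟨p.src.shift p.ν, p.μ⟩) * star ((W ⟨p.src, p.μ⟩ * W ⟨p.src.shift p.μ, p.ν⟩ * (W ⟨p.src.shift p.ν, p.μ⟩)⁻¹ : Matrix.specialUnitaryGroup (Fin 2) ℂ) : Matrix (Fin 2) (Fin 2) ℂ))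
            - (((GaugeField.plaqHol W p : Matrix.specialUnitaryGroup (Fin 2) ℂ) : Matrix (Fin 2) (Fin 2) ℂ) * (Complex.I • D ⟨p.src, p.ν⟩) * star ((GaugeField.plaqHol W p : Matrix.specialUnitaryGroup (Fin 2) ℂ) : Matrix (Fin 2) (Fin 2) ℂ)))‖ ^ 2 with hKc
  set Lc : ℝ := ∑ p : Plaq (F.P K) 0, (1 / 2) * (((((GaugeField.plaqHol W p : Matrix.specialUnitaryGroup (Fin 2) ℂ) : Matrix (Fin 2) (Fin 2) ℂ) - 1)ᴴ * (((Complex.I • D ⟨p.src, p.μ⟩) + ((W ⟨p.src, p.μ⟩ : Matrix (Fin 2) (Fin 2) ℂ) * (Complex.I • D ⟨p.src.shift p.μ, p.ν⟩) * star (W ⟨p.src, p.μ⟩ : Matrix (Fin 2) (Fin 2) ℂ))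
            - (((W ⟨p.src, p.μ⟩ * W ⟨p.src.shift p.μ, p.ν⟩ * (W ⟨p.src.shift p.ν, p.μ⟩)⁻¹ : Matrix.specialUnitaryGroup (Fin 2) ℂ) : Matrix (Fin 2) (Fin 2) ℂ) * (Complex.I • D ⟨p.src.shift p.ν, p.μ⟩) * star ((W ⟨p.src, p.μ⟩ * W ⟨p.src.shift p.μ, p.ν⟩ * (W ⟨p.src.shift p.ν, p.μ⟩)⁻¹ : Matrix.specialUnitaryGroup (Fin 2) ℂ) : Matrix (Fin 2) (Fin 2) ℂ))
            - (((GaugeField.plaqHol W p : Matrix.specialUnitaryGroup (Fin 2) ℂ) : Matrix (Fin 2) (Fin 2) ℂ) * (Complex.I • D ⟨p.src, p.ν⟩) * star ((GaugeField.plaqHol W p : Matrix.specialUnitaryGroup (Fin 2) ℂ) : Matrix (Fin 2) (Fin 2) ℂ))) * ((GaugeField.plaqHol W p : Matrix.specialUnitaryGroup (Fin 2) ℂ) : Matrix (Fin 2) (Fin 2) ℂ))).trace).re with hLc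
  have hM0 : 0 ≤ M := Finset.sum_nonneg fun _ _ => sq_nonneg _
  have hK0 : 0 ≤ Kc := Finset.sum_nonneg fun _ _ => sq_nonneg _
  have hco : 0 ≤ 2 * ε₀ * ℓ⁻¹ := mul_nonneg (mul_nonneg (by norm_num) hε₀) (inv_nonneg.mpr hℓ0.le)
  -- (141) in the `Q`-currency, spread over the two budgets
  have h1 : |Lc| ≤ 2 * ε₀ * C₁ * (ℓ ^ 2)⁻¹ * M + 2 * ε₀ * C₂ * Kc := by
    have := hELQ.trans (mul_le_mul_of_nonneg_left hR hco)
    have e1 : 2 * ε₀ * ℓ⁻¹ * (C₁ * ℓ⁻¹ * M + C₂ * ℓ * Kc) = 2 * ε₀ * C₁ * (ℓ ^ 2)⁻¹ * M + 2 * ε₀ * C₂ * Kc := by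
      field_simp
    linarith [e1]
  have h2 : 2 * ε₀ * C₂ * Kc ≤ 1 / 8 * Kc := mul_le_mul_of_nonneg_right hw₁ hK0
  -- the regularity threshold bounds the background's plaquette defects (as in ✓`wilsonAction4_le_expChart_of_linRow`)
  have he0 : 0 < e := pos_of_regPr F hreg
  have hthr0 : 0 ≤ regThreshold F n K e := by unfold regThreshold; positivity
  have ha : ∀ p : Plaq (F.P K) 0, ‖((GaugeField.plaqHol W p : Matrix.specialUnitaryGroup (Fin 2) ℂ) : Matrix (Fin 2) (Fin 2) ℂ) - 1‖ ≤ regThreshold F n K e := fun p => by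
    have hp := hreg.1 p
    rw [SU2Mean.dist1_eq_norm] at hp
    exact hp.le
  -- scale-aware Taylor at `θ = 1∕3`
  have hT := wilsonAction4_expChart_sub_lin_ge W D hDh hDs hs4 hthr0 ha (θ := 1 / 3) (by norm_num) (by norm_num)
  rw [show ((1 : ℝ) - 1 / 3) / 2 = 1 / 3 by norm_num, show (7776 : ℝ) * (1 / 3)⁻¹ = 23328 by norm_num] at hT
  change 1 / 3 * Kc - (23328 * s ^ 2 + 216 * regThreshold F n K e) * M ≤ wilsonAction4 (emb15 W (expHermField D)) - wilsonAction4 W - Lc at hT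
  have habs := neg_abs_le Lc
  -- the `s²` budget: `15552 s² ≤ κ∕8`
  have hε₁ : 0 ≤ 2 * ε₀ * C₁ * (ℓ ^ 2)⁻¹ := mul_nonneg (mul_nonneg (mul_nonneg (by norm_num) hε₀) hC₁) (inv_nonneg.mpr (sq_nonneg ℓ))
  have hs2 : 7776 * s ^ 2 * M ≤ κ / 16 * M := by
    refine mul_le_mul_of_nonneg_right ?_ hM0
    linarith [hw₂, hε₁, hthr0]
  have h3 : (2 * ε₀ * C₁ * (ℓ ^ 2)⁻¹ + 15552 * s ^ 2 + 216 * regThreshold F n K e) * M ≤ κ / 8 * M := mul_le_mul_of_nonneg_right hw₂ hM0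
  linarith [h1, h2, h3, hq, hK0, hT, habs, hs2, hM0]

omit F in
/-- RATE bookkeeping: under the windows `2B₀(2442 + kQ′ + 1)e ≤ 1` and `kQ·e ≤ 1`, the HESS constant `κ = (B₀⁻¹ − (2442 + kQ′)e)∕((4 + kQ·e)ℓ²)` of the E2E knit satisfies
`(480·B₀)⁻¹·ℓ⁻² ≤ κ∕48`. [bookkeeping; cite: Balaban1985BackgroundPropagators, Thm 3.11 p.416] -/
theorem rate_arith {B₀ kQ kQ' e ℓ : ℝ} (hB₀ : 0 < B₀) (hkQ : 0 ≤ kQ) (hkQ' : 0 ≤ kQ') (he : 0 < e) (hℓ : 0 < ℓ)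
    (w3 : 2 * B₀ * (2442 + kQ' + 1) * e ≤ 1) (w9 : kQ * e ≤ 1) :
    (480 * B₀)⁻¹ * (ℓ ^ 2)⁻¹ ≤ (B₀⁻¹ - (2442 + kQ') * e) / ((4 + kQ * e) * ℓ ^ 2) / 48 := by
  have hℓ2 : (0 : ℝ) < ℓ ^ 2 := by positivity
  have hB₀inv : (0 : ℝ) < B₀⁻¹ := inv_pos.mpr hB₀
  have hN : B₀⁻¹ / 2 ≤ B₀⁻¹ - (2442 + kQ') * e := by
    have h2' : (2442 + kQ') * e * (2 * B₀) ≤ 1 := by nlinarith [mul_pos hB₀ he]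
    have h3' : (2442 + kQ') * e ≤ B₀⁻¹ / 2 := by
      rw [le_div_iff₀ (by norm_num : (0:ℝ) < 2)]
      calc (2442 + kQ') * e * 2 = (2442 + kQ') * e * (2 * B₀) * B₀⁻¹ := by field_simp
        _ ≤ 1 * B₀⁻¹ := mul_le_mul_of_nonneg_right h2' hB₀inv.le
        _ = B₀⁻¹ := one_mul _
    linarith
  have hD : 0 < 4 + kQ * e := by nlinarith [mul_nonneg hkQ he.le]
  have hDle : 4 + kQ * e ≤ 5 := by linarith
  rw [div_div, le_div_iff₀ (by positivity)]
  calc (480 * B₀)⁻¹ * (ℓ ^ 2)⁻¹ * ((4 + kQ * e) * ℓ ^ 2 * 48)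
      = (B₀⁻¹ / 2) * ((4 + kQ * e) / 5) := by field_simp; ring
    _ ≤ (B₀⁻¹ - (2442 + kQ') * e) * 1 := by
        refine mul_le_mul hN ?_ (by positivity) ?_
        · rw [div_le_one (by norm_num : (0:ℝ) < 5)]; exact hDle
        · linarith
    _ = B₀⁻¹ - (2442 + kQ') * e := mul_one _

end Door

end Summit.QuantumFields.YangMills.Theorems.FluctuationComparisonRegPrIntLS2BetaSigmaGrowthDoor

end
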